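import Summits.CriticalPhenomena.PercolationContinuityZ3.Theses.PercTreeValue

/-!
# `AssemblyViaThreePoint` — the three-point spine assembly of route PercTreeValue

We prove the support item `AssemblyViaThreePoint` of route `PercTreeValue`
(sub-problem `PercolationContinuityZ3` of `CriticalPhenomena`):

`ConnectionPatternFactorisation → EquilateralAntiFactorisation → PercolationContinuityZ3`.

Argument (pure limit bookkeeping): suppose `θ := θ(p_c) ≠ 0`, so `θ > 0`. Pattern-blindness
(`ConnectionPatternFactorisation`) applied at `p = p_c` with `k = 3`, pattern `{(0,1),(0,2)}` on the
equilateral face `A_n = (0, a_n, b_n)`, `a_n = (n,n,0)`, `b_n = (n,0,n)` gives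
`P(0 ↔ a_n ∧ 0 ↔ b_n) → θ³`; with `k = 2`, pattern `{(0,1)}` on the three pairs `(0,a_n)`,
`(a_n,b_n)`, `(b_n,0)` it gives each `τ → θ²`. Passing to the limit in the crux inequality
`(1+δ) τ(0,a_r) τ(a_r,b_r) τ(b_r,0) ≤ P(0 ↔ a_r ↔ b_r)²` yields `(1+δ) θ⁶ ≤ θ⁶`, absurd for
`δ > 0`, `θ > 0`. Hence `θ(p_c) = 0`, which is `PercolationContinuityZ3` by `Iff.rfl`.
-/

namespace Summit.CriticalPhenomena.PercolationContinuityZ3.Theorems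

open Filter MeasureTheory
open Summit.CriticalPhenomena.PercolationContinuityZ3.Theses.PercTreeValue

/-- **Support item `AssemblyViaThreePoint` (route PercTreeValue).**
Pattern-blindness of a jump (`ConnectionPatternFactorisation`) together with strict
anti-factorisation of the critical three-point function on the equilateral face of the lattice
tetrahedron (`EquilateralAntiFactorisation`) imply `θ(p_c(ℤ³)) = 0`: in a jump world the
three-point probability tends to `θ³` and each two-point function to `θ²`, so the crux inequality
passes to the limit as `(1+δ) θ⁶ ≤ θ⁶`, contradicting `δ > 0`, `θ > 0`. -/
theorem assemblyViaThreePoint_proof : AssemblyViaThreePoint := by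
  unfold AssemblyViaThreePoint
  intro hF hE
  classical
  refine Literature.Probability.Percolation.percolationContinuityZ3_iff.mpr ?_
  by_contra hne
  -- θ := θ(p_c) > 0 in the jump world
  have hθnn : 0 ≤ Literature.Probability.Percolation.theta (Literature.Probability.LatticeModels.zdGraph 3)
      (0 : Literature.Probability.LatticeModels.Site 3) (Literature.Probability.Percolation.criticalProbI 3) := by
    unfold Literature.Probability.Percolation.theta
    exact measureReal_nonneg
  have hθpos : 0 < Literature.Probability.Percolation.theta (Literature.Probability.LatticeModels.zdGraph 3)
      (0 : Literature.Probability.LatticeModels.Site 3) (Literature.Probability.Percolation.criticalProbI 3) :=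
    lt_of_le_of_ne hθnn (Ne.symm hne)
  -- coordinate lower bound ⇒ sup-norm distances tend to ∞
  have key : ∀ (l : Fin 3) (f : ℕ → Literature.Probability.LatticeModels.Site 3),
      (∀ n : ℕ, ‖f n l‖ = (n : ℝ)) → Filter.Tendsto (fun n => ‖f n‖) Filter.atTop Filter.atTop := by
    intro l f hf
    refine Filter.tendsto_atTop_mono (fun n => ?_) tendsto_natCast_atTop_atTop
    rw [← hf n]
    exact norm_le_pi_norm (f n) l
  -- the equilateral face (0, a_n, b_n) and its three edges as 2-point configurations
  let A3 : ℕ → Fin 3 → Literature.Probability.LatticeModels.Site 3 := fun n =>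
    ![(0 : Literature.Probability.LatticeModels.Site 3), ![(n : ℤ), (n : ℤ), 0], ![(n : ℤ), 0, (n : ℤ)]]
  let A2 : ℕ → Fin 2 → Literature.Probability.LatticeModels.Site 3 := fun n =>
    ![(0 : Literature.Probability.LatticeModels.Site 3), ![(n : ℤ), (n : ℤ), 0]]
  let B2 : ℕ → Fin 2 → Literature.Probability.LatticeModels.Site 3 := fun n =>
    ![![(n : ℤ), (n : ℤ), 0], ![(n : ℤ), 0, (n : ℤ)]]
  let C2 : ℕ → Fin 2 → Literature.Probability.LatticeModels.Site 3 := fun n =>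
    ![![(n : ℤ), 0, (n : ℤ)], (0 : Literature.Probability.LatticeModels.Site 3)]
  have hdist3 : ∀ i j : Fin 3, i ≠ j →
      Filter.Tendsto (fun n => ‖A3 n i - A3 n j‖) Filter.atTop Filter.atTop := by
    intro i j hij
    fin_cases i <;> fin_cases j <;> (first | exact absurd rfl hij | skip) <;>
      first
        | (refine key 0 _ (fun n => ?_); simp [A3]; done)
        | (refine key 1 _ (fun n => ?_); simp [A3])
  have hdist2 : ∀ i j : Fin 2, i ≠ j →
      Filter.Tendsto (fun n => ‖A2 n i - A2 n j‖) Filter.atTop Filter.atTop := by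
    intro i j hij
    fin_cases i <;> fin_cases j <;> (first | exact absurd rfl hij | skip) <;>
      (refine key 0 _ (fun n => ?_); simp [A2])
  have hdistB : ∀ i j : Fin 2, i ≠ j →
      Filter.Tendsto (fun n => ‖B2 n i - B2 n j‖) Filter.atTop Filter.atTop := by
    intro i j hij
    fin_cases i <;> fin_cases j <;> (first | exact absurd rfl hij | skip) <;>
      (refine key 1 _ (fun n => ?_); simp [B2])
  have hdistC : ∀ i j : Fin 2, i ≠ j →
      Filter.Tendsto (fun n => ‖C2 n i - C2 n j‖) Filter.atTop Filter.atTop := by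
    intro i j hij
    fin_cases i <;> fin_cases j <;> (first | exact absurd rfl hij | skip) <;>
      (refine key 0 _ (fun n => ?_); simp [C2])
  -- pattern-blindness limits from ConnectionPatternFactorisation
  have hF' := hF
  unfold ConnectionPatternFactorisation at hF'
  have h3 := hF' (Literature.Probability.Percolation.criticalProbI 3) 3 {((0 : Fin 3), (1 : Fin 3)), (0, 2)}
    (by decide) (by decide) A3 hdist3
  have h2a := hF' (Literature.Probability.Percolation.criticalProbI 3) 2 {((0 : Fin 2), (1 : Fin 2))}
    (by decide) (by decide) A2 hdist2
  have h2b := hF' (Literature.Probability.Percolation.criticalProbI 3) 2 {((0 : Fin 2), (1 : Fin 2))}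
    (by decide) (by decide) B2 hdistB
  have h2c := hF' (Literature.Probability.Percolation.criticalProbI 3) 2 {((0 : Fin 2), (1 : Fin 2))}
    (by decide) (by decide) C2 hdistC
  have hlim3 : Filter.Tendsto (fun r : ℕ =>
      (Literature.Probability.Percolation.bondPercolation (Literature.Probability.LatticeModels.zdGraph 3)
        (Literature.Probability.Percolation.criticalProbI 3)).real
        (Literature.Probability.Percolation.openConn 0 ![(r : ℤ), (r : ℤ), 0] ∩
          Literature.Probability.Percolation.openConn 0 ![(r : ℤ), 0, (r : ℤ)]))
      Filter.atTop (nhds (Literature.Probability.Percolation.theta (Literature.Probability.LatticeModels.zdGraph 3) 0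
        (Literature.Probability.Percolation.criticalProbI 3) ^ 3)) := by
    refine Filter.Tendsto.congr (fun r => ?_) h3
    simp [A3]
  have hlim2a : Filter.Tendsto (fun r : ℕ =>
      Literature.Probability.Percolation.tau 3 (Literature.Probability.Percolation.criticalProbI 3) 0 ![(r : ℤ), (r : ℤ), 0])
      Filter.atTop (nhds (Literature.Probability.Percolation.theta (Literature.Probability.LatticeModels.zdGraph 3) 0
        (Literature.Probability.Percolation.criticalProbI 3) ^ 2)) := by
    refine Filter.Tendsto.congr (fun r => ?_) h2a
    simp [A2, Literature.Probability.Percolation.tau_def]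
  have hlim2b : Filter.Tendsto (fun r : ℕ =>
      Literature.Probability.Percolation.tau 3 (Literature.Probability.Percolation.criticalProbI 3) ![(r : ℤ), (r : ℤ), 0] ![(r : ℤ), 0, (r : ℤ)])
      Filter.atTop (nhds (Literature.Probability.Percolation.theta (Literature.Probability.LatticeModels.zdGraph 3) 0
        (Literature.Probability.Percolation.criticalProbI 3) ^ 2)) := by
    refine Filter.Tendsto.congr (fun r => ?_) h2b
    simp [B2, Literature.Probability.Percolation.tau_def]
  have hlim2c : Filter.Tendsto (fun r : ℕ =>
      Literature.Probability.Percolation.tau 3 (Literature.Probability.Percolation.criticalProbI 3) ![(r : ℤ), 0, (r : ℤ)] 0)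
      Filter.atTop (nhds (Literature.Probability.Percolation.theta (Literature.Probability.LatticeModels.zdGraph 3) 0
        (Literature.Probability.Percolation.criticalProbI 3) ^ 2)) := by
    refine Filter.Tendsto.congr (fun r => ?_) h2c
    simp [C2, Literature.Probability.Percolation.tau_def]
  -- pass to the limit in the strict anti-factorisation inequality
  obtain ⟨δ, hδ, r₀, hr⟩ := hE
  have hlimL := (((hlim2a.const_mul (1 + δ)).mul hlim2b).mul hlim2c)
  have hlimR := hlim3.pow 2
  have hle := le_of_tendsto_of_tendsto hlimL hlimR (Filter.eventually_atTop.2 ⟨r₀, fun r hr' => hr r hr'⟩)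
  have h6pos := pow_pos hθpos 6
  have h6 : (Literature.Probability.Percolation.theta (Literature.Probability.LatticeModels.zdGraph 3) 0
      (Literature.Probability.Percolation.criticalProbI 3) ^ 3) ^ 2 =
      Literature.Probability.Percolation.theta (Literature.Probability.LatticeModels.zdGraph 3) 0
      (Literature.Probability.Percolation.criticalProbI 3) ^ 2 *
      Literature.Probability.Percolation.theta (Literature.Probability.LatticeModels.zdGraph 3) 0
      (Literature.Probability.Percolation.criticalProbI 3) ^ 2 *
      Literature.Probability.Percolation.theta (Literature.Probability.LatticeModels.zdGraph 3) 0
      (Literature.Probability.Percolation.criticalProbI 3) ^ 2 := by ring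
  have h6' : Literature.Probability.Percolation.theta (Literature.Probability.LatticeModels.zdGraph 3) 0
      (Literature.Probability.Percolation.criticalProbI 3) ^ 2 *
      Literature.Probability.Percolation.theta (Literature.Probability.LatticeModels.zdGraph 3) 0
      (Literature.Probability.Percolation.criticalProbI 3) ^ 2 *
      Literature.Probability.Percolation.theta (Literature.Probability.LatticeModels.zdGraph 3) 0
      (Literature.Probability.Percolation.criticalProbI 3) ^ 2 =
      Literature.Probability.Percolation.theta (Literature.Probability.LatticeModels.zdGraph 3) 0
      (Literature.Probability.Percolation.criticalProbI 3) ^ 6 := by ring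
  rw [h6, h6'] at hle
  nlinarith [mul_pos hδ h6pos, hle]

end Summit.CriticalPhenomena.PercolationContinuityZ3.Theorems
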